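import Summits.ValiantsHypothesis.ValiantsHypothesis.Theorems.SymPencilPerFourPeeledTwoPencilSigmaZero

/-!
# Route `SymPencil` — inner rank of the `2 | 2` row split of `per_4`, PEELED case: TRANSPORT of
# Hessian-level two-pencil frames (`--supports` stmt-ValiantsHypothesis-5674 `SdcSuperquadratic`;
# (8,8) column, memo `NOTE-p8g15-5674-R2-two-pencil.md` §3/§7; rung currency only)

For `a` with non-zero coordinates, `[per(a; e_b; a∘z; e_l)] = (Π a) · D_a⁻¹ 𝐇(z) D_a⁻¹` with the
Hessian-type matrix `𝐇(z) = [σ(z) - z_b - z_l]_{b ≠ l}` (`= [per(𝟙; e_b; z; e_l)]`,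
`…PeeledHessian.per_one_single_single`): `transport_hess`.  Consequently two-pencil frame data can be
produced at the level of the 𝐇-PENCIL `(𝐇(z₀), 𝐇(z₁))` — a left inverse `Ŵ₀ 𝐇(z₀) = 1`, an
eigenbasis `𝐇(z₁) v̂_j = ŝ_j 𝐇(z₀) v̂_j` with pairwise distinct `ŝ`, `Ŵ · of v̂ = 1` — and
transported: **`false_of_hess_frame`** feeds `W₀ = (Π a₀)⁻¹ D Ŵ₀ D`, `v_j = a₀ ∘ v̂_j`, `ŝ`,
`W = D⁻¹ Ŵ` to `…TwoPencilDesign.false_of_frame`.  So a frame CLASS file only has to (i) exhibit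
`z₀, z₁` with `ψ(a_j, a₀∘z_i) = 0`, (ii) give 𝐇-pencil data (e.g. `…PeeledHessian` Case A, or the
Σ₀ constants of `…TwoPencilSigmaZeroGeneral`), (iii) prove `Q ≠ 0`.

Honest framing: infrastructure for the frame-existence case analysis of HR2(11); no cell closes
here; the window of record, the crux `SdcSuperquadratic` and `VP ≠ VNP` are untouched.
No definitions, no named facts. [folklore]
-/

noncomputable section

-- single-conjunct layout: Sub = Summit, duplicated namespace component intended
set_option linter.dupNamespace false

namespace Summit.ValiantsHypothesis.ValiantsHypothesis.Theorems.SymPencilPerFourPeeledTwoPencilTransport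

open Matrix Finset Module
open Summit.ValiantsHypothesis.ValiantsHypothesis.Theorems.SymPencilPerFourInnerRankRows
open Summit.ValiantsHypothesis.ValiantsHypothesis.Theorems.SymPencilPerFourPeeledTwoPencilDesign
open Summit.ValiantsHypothesis.ValiantsHypothesis.Theorems.SymPencilPerFourPeeledTwoPencilSigmaZero

universe u v

variable {K : Type u} [Field K]

/-- **Transport to the Hessian pencil**: `[per(a; e_b; a∘z; e_l)] = (Π a) · D_a⁻¹ 𝐇(z) D_a⁻¹`
for `a` with non-zero coordinates, `𝐇(z)_{bl} = σ(z) - z_b - z_l` (`b ≠ l`), `0` on the diagonal.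
[folklore] -/
theorem transport_hess (a z : Fin 4 → K) (ha : ∀ k, a k ≠ 0) (H : Matrix (Fin 4) (Fin 4) K)
    (hH : ∀ b l, H b l = if b = l then 0 else (z 0 + z 1 + z 2 + z 3) - z b - z l) :
    (Matrix.of fun b l : Fin 4 =>
        (Matrix.of ![a, Pi.single b (1 : K), (fun k => a k * z k), Pi.single l 1]).permanent) =
      (a 0 * a 1 * a 2 * a 3) • (Matrix.diagonal (fun k => (a k)⁻¹) * H *
        Matrix.diagonal (fun k => (a k)⁻¹)) := by
  ext b l
  rw [Matrix.of_apply, per_single_had_div a z ha b l, Matrix.smul_apply, smul_eq_mul,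
    Matrix.mul_diagonal, Matrix.diagonal_mul, hH]
  have hb := ha b; have hl := ha l
  split_ifs <;> field_simp; ring

/-- **Two-pencil frames from Hessian-pencil data.**  See the module docstring. [folklore] -/
theorem false_of_hess_frame [CharZero K] {κ : Type v} [Fintype κ] [DecidableEq κ]
    (hκ : Fintype.card κ ≤ 11) (c : κ → K)
    (t : κ → (((Fin 4 → K) × (Fin 4 → K)) →ₗ[K] ((Fin 4 → K) × (Fin 4 → K)) →ₗ[K] K))
    (hJ : ∀ a b y₂ y₃ : Fin 4 → K,
      ∑ r, c r * (t r (a, b) (y₂, y₃)) ^ 2 = (Matrix.of ![a, b, y₂, y₃]).permanent)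
    (v₀ v₀' : κ → K) (hv₀ : ∀ (a x : Fin 4 → K), ∃ s : K, (fun r => t r (a, 0) (x, 0)) = s • v₀)
    (hv₀' : ∀ (b x : Fin 4 → K), ∃ s : K, (fun r => t r (0, b) (0, x)) = s • v₀')
    (hpeel : ∃ a b y z : Fin 4 → K, ∑ r, c r * t r (a, 0) (y, 0) * t r (0, b) (0, z) ≠ 0)
    (a₀ a₁ z₀ z₁ : Fin 4 → K) (ha : ∀ k, a₀ k ≠ 0)
    (hψ₀₀ : ∀ r, t r (a₀, 0) ((fun k => a₀ k * z₀ k), 0) = 0)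
    (hψ₀₁ : ∀ r, t r (a₀, 0) ((fun k => a₀ k * z₁ k), 0) = 0)
    (hψ₁₀ : ∀ r, t r (a₁, 0) ((fun k => a₀ k * z₀ k), 0) = 0)
    (hψ₁₁ : ∀ r, t r (a₁, 0) ((fun k => a₀ k * z₁ k), 0) = 0)
    (H₀ H₁ : Matrix (Fin 4) (Fin 4) K)
    (hH₀ : ∀ b l, H₀ b l = if b = l then 0 else (z₀ 0 + z₀ 1 + z₀ 2 + z₀ 3) - z₀ b - z₀ l)
    (hH₁ : ∀ b l, H₁ b l = if b = l then 0 else (z₁ 0 + z₁ 1 + z₁ 2 + z₁ 3) - z₁ b - z₁ l)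
    (Wh₀ : Matrix (Fin 4) (Fin 4) K) (hWh₀ : Wh₀ * H₀ = 1)
    (vh : Fin 4 → Fin 4 → K) (sh : Fin 4 → K) (hvh : ∀ j, H₁ *ᵥ vh j = sh j • H₀ *ᵥ vh j)
    (hsh : ∀ i j, i ≠ j → sh i ≠ sh j) (Wh : Matrix (Fin 4) (Fin 4) K)
    (hWh : Wh * Matrix.of vh = 1)
    (hQ : (Matrix.of fun b l : Fin 4 =>
          (Matrix.of ![a₁, Pi.single b (1 : K), (fun k => a₀ k * z₁ k), Pi.single l 1]).permanent) -
        (Matrix.of fun b l : Fin 4 =>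
          (Matrix.of ![a₀, Pi.single b (1 : K), (fun k => a₀ k * z₁ k), Pi.single l 1]).permanent) *
        ((a₀ 0 * a₀ 1 * a₀ 2 * a₀ 3)⁻¹ • (Matrix.diagonal a₀ * Wh₀ * Matrix.diagonal a₀)) *
        (Matrix.of fun b l : Fin 4 =>
          (Matrix.of ![a₁, Pi.single b (1 : K), (fun k => a₀ k * z₀ k), Pi.single l 1]).permanent)
        ≠ 0) : False := by
  let y₀ : Fin 4 → K := fun k => a₀ k * z₀ k
  let y₁ : Fin 4 → K := fun k => a₀ k * z₁ k
  let P₀₀ : Matrix (Fin 4) (Fin 4) K :=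
    Matrix.of fun b l => (Matrix.of ![a₀, Pi.single b 1, y₀, Pi.single l 1]).permanent
  let P₁₀ : Matrix (Fin 4) (Fin 4) K :=
    Matrix.of fun b l => (Matrix.of ![a₀, Pi.single b 1, y₁, Pi.single l 1]).permanent
  let P₀₁ : Matrix (Fin 4) (Fin 4) K :=
    Matrix.of fun b l => (Matrix.of ![a₁, Pi.single b 1, y₀, Pi.single l 1]).permanent
  let P₁₁ : Matrix (Fin 4) (Fin 4) K :=
    Matrix.of fun b l => (Matrix.of ![a₁, Pi.single b 1, y₁, Pi.single l 1]).permanent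
  set pa : K := a₀ 0 * a₀ 1 * a₀ 2 * a₀ 3 with hpa
  have hpa0 : pa ≠ 0 := by
    rw [hpa]; exact mul_ne_zero (mul_ne_zero (mul_ne_zero (ha 0) (ha 1)) (ha 2)) (ha 3)
  let D : Matrix (Fin 4) (Fin 4) K := Matrix.diagonal a₀
  let Di : Matrix (Fin 4) (Fin 4) K := Matrix.diagonal fun k => (a₀ k)⁻¹
  have hDDi : D * Di = 1 := by
    rw [Matrix.diagonal_mul_diagonal, ← Matrix.diagonal_one]
    congr 1; funext k; exact mul_inv_cancel₀ (ha k)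
  have hDiD : Di * D = 1 := by
    rw [Matrix.diagonal_mul_diagonal, ← Matrix.diagonal_one]
    congr 1; funext k; exact inv_mul_cancel₀ (ha k)
  have T0 : P₀₀ = pa • (Di * H₀ * Di) := transport_hess a₀ z₀ ha H₀ hH₀
  have T1 : P₁₀ = pa • (Di * H₁ * Di) := transport_hess a₀ z₁ ha H₁ hH₁
  -- W₀
  let W₀ : Matrix (Fin 4) (Fin 4) K := pa⁻¹ • (D * Wh₀ * D)
  have hW₀ : W₀ * P₀₀ = 1 := by
    show (pa⁻¹ • (D * Wh₀ * D)) * P₀₀ = 1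
    rw [T0, Matrix.smul_mul, Matrix.mul_smul, smul_smul, inv_mul_cancel₀ hpa0, one_smul]
    calc D * Wh₀ * D * (Di * H₀ * Di) = D * (Wh₀ * ((D * Di) * H₀)) * Di := by
          simp only [Matrix.mul_assoc]
      _ = 1 := by rw [hDDi, Matrix.one_mul, hWh₀, Matrix.mul_one, hDDi]
  -- eigen-data
  let v : Fin 4 → Fin 4 → K := fun j k => a₀ k * vh j k
  have hvD : ∀ j, v j = D *ᵥ vh j := fun j => by
    funext k; simp [v, D, Matrix.mulVec_diagonal]
  have hDD : ∀ M : Matrix (Fin 4) (Fin 4) K, Di * M * Di * D = Di * M := fun M => by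
    rw [Matrix.mul_assoc, hDiD, Matrix.mul_one]
  have hv : ∀ j, P₁₀ *ᵥ v j = sh j • P₀₀ *ᵥ v j := by
    intro j
    rw [T0, T1, hvD, Matrix.smul_mulVec, Matrix.smul_mulVec, Matrix.mulVec_mulVec,
      Matrix.mulVec_mulVec, hDD, hDD, ← Matrix.mulVec_mulVec, ← Matrix.mulVec_mulVec, hvh,
      Matrix.mulVec_smul, smul_smul, smul_smul, mul_comm]
  let W : Matrix (Fin 4) (Fin 4) K := Di * Wh
  have hW : W * Matrix.of v = 1 := by
    have hofv : Matrix.of v = Matrix.of vh * D := by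
      ext i k; simp [v, D, Matrix.mul_diagonal, mul_comm]
    show Di * Wh * Matrix.of v = 1
    rw [hofv, Matrix.mul_assoc, ← Matrix.mul_assoc Wh, hWh, Matrix.one_mul, hDiD]
  exact false_of_frame hκ c t hJ v₀ v₀' hv₀ hv₀' hpeel a₀ a₁ y₀ y₁
    hψ₀₀ hψ₀₁ hψ₁₀ hψ₁₁ P₀₀ P₁₀ P₀₁ P₁₁
    (fun b l => rfl) (fun b l => rfl) (fun b l => rfl) (fun b l => rfl) W₀ hW₀ v sh hv hsh W hW hQ

end Summit.ValiantsHypothesis.ValiantsHypothesis.Theorems.SymPencilPerFourPeeledTwoPencilTransport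

end
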